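import Summits.HodgeConjecture.CorCM.Census.CentralSquaresDihedralFrame

/-!
# The square-central class, XL: THE KERNEL-FOUR LAW — `π : G ↠ D₄`, `|ker π| = 4`, a lift of `s` of order `4` ⟹ `μ(G, c) = φ₂(G, c)`

COR-CM (cell `pub-hodgecm2`), count-neutral kernel combinatorics by the binder seat b09 (gen 47; lane SQUARE-CENTRAL CLASS, part XL), the INSTANCE of
part XXXVIIIʼs orbit frame law (`isLeast_card_gfaces_generate_orbit_four`) along a dihedral quotient, with part XXXIXʼs datum (`dq_*`) BY NAME.
Theorems only: no definition, no certificate, no named fact, no `sorry`; eight-element facts about `D₄` by `decide`.  HONEST FRAMING: `HC_CM` is NOT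
proved, here or anywhere in the tree; nothing here is a period or a headline.

**THE KERNEL-FOUR LAW, ORDER-`4` CASE (`isLeast_card_gfaces_generate_of_dihedral_kernel_four_of_order_four`).**  `G` finite, `c` a central
involution, `π : G ↠ D₄` with `π c = r²` and `|ker π| = 4`, `q` a lift of `s` with `q² ≠ 1`, `q⁴ = 1`: **`μ(G, c) = φ₂(G, c)`**.  This is the case
left open by part X (an involutive lift of `s`) at kernel order `4`: all `28` configurations of order `32` with a reflection lift of order `4` and none
of order `2` (own census, design note `KERNEL-FOUR.md`: groups #13, #16 with `K = V₄` central — e.g. `(ℤ/4 ⋊ ℤ/4) × ℤ/2` —, #33, #41 with `K = C₄`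
non-central — e.g. `Q₁₆ × ℤ/2` —, #43).  Datum: `T₀ = π⁻¹{1, r, s, sr}`, swaps `Q = q` and `Q' = c·g₁qg₁⁻¹` (`g₁` a lift of `sr`), transversals
`T = π⁻¹(r)`, `A' = π⁻¹(s)`, the `4`-cycle `(1, q, q², q³)` of `q` inside `T₀ ∩ T₁`, the orbit type `Φ = {T ∣ 1, q, q², q³}`; the designated faces
required by the frame law are the translates of the prescribed face of `Φ` at `1, q` by the kernel (`dq_cycle_translate`) and by `g₁`.

## References
* [Pohlmann1968] H. Pohlmann, Algebraic cycles on abelian varieties of complex multiplication type, Ann. of Math. 88 (1968), Thm 1.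
* [Milne1999] J. S. Milne, Lefschetz motives and the Tate conjecture, Compositio Math. 117 (1999), Prop. 2.1, p. 54.
-/

namespace Summit.HodgeConjecture.CorCM.Census.CentralSquares

open Finset DihedralGroup
open Summit.HodgeConjecture.CorCM.Prior.AllgGroup.RfwfAllgGroup
open Summit.HodgeConjecture.CorCM.Census.BlockParity
open Summit.HodgeConjecture.CorCM.Census.Coinvariant
open Summit.HodgeConjecture.CorCM.Census.TwistGeneration
open Summit.HodgeConjecture.CorCM.Census.BaseBlock
open Summit.HodgeConjecture.CorCM.Census.CoverClosure

noncomputable section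

variable {G : Type*} [Group G] [Fintype G] [DecidableEq G]

/-! ## §1 Translating deviation sets and fibres -/

/-- **Deviation sets under a base change stabilising `T₀`**: `T₀ ∖ Θ·g⁻¹ = (T₀ ∖ Θ)·g⁻¹`. [folklore] -/
theorem dev_rt_of_stab {c : G} (T₀ Θ : CMF G c) (g : G) (hg : rt c g T₀ = T₀) :
    T₀.1 \ (rt c g Θ).1 = (T₀.1 \ Θ.1).image (fun x => x * g⁻¹) := by
  ext P
  rw [mem_image]
  constructor
  · intro hP
    have h : P ∈ (rt c g T₀).1 \ (rt c g Θ).1 := by rw [hg]; exact hP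
    rw [mem_sdiff_rt_iff] at h
    exact ⟨P * g, h, by rw [mul_inv_cancel_right]⟩
  · rintro ⟨x, hx, rfl⟩
    have h : x * g⁻¹ ∈ (rt c g T₀).1 \ (rt c g Θ).1 := by rw [mem_sdiff_rt_iff, inv_mul_cancel_right]; exact hx
    rwa [hg] at h

/-- **A fibre of `π` translated**: `π⁻¹(y)·g⁻¹ = π⁻¹(y·π(g)⁻¹)`. [folklore] -/
theorem image_fibre (π : G →* DihedralGroup 4) (y : DihedralGroup 4) (g : G) :
    (univ.filter fun x : G => π x = y).image (fun x => x * g⁻¹) = univ.filter fun x : G => π x = y * (π g)⁻¹ := by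
  ext P
  simp only [mem_image, mem_filter, mem_univ, true_and]
  constructor
  · rintro ⟨x, hx, rfl⟩; rw [map_mul, map_inv, hx]
  · intro h; exact ⟨P * g, by rw [map_mul, h, inv_mul_cancel_right], by rw [mul_inv_cancel_right]⟩

omit [Group G] [Fintype G] in
/-- Reordering a four-element set: swap the first two and the last two entries. [folklore] -/
theorem four_swap_pairs (a b d e : G) : ({a, b, d, e} : Finset G) = {b, a, e, d} := by
  ext x; simp only [mem_insert, mem_singleton]; tauto

omit [Group G] [Fintype G] in
/-- The translate of a four-element set. [folklore] -/
theorem image_four (f : G → G) (a₀ a₁ a₂ a₃ : G) :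
    ({a₀, a₁, a₂, a₃} : Finset G).image f = {f a₀, f a₁, f a₂, f a₃} := by
  simp only [image_insert, image_singleton]

/-! ## §2 THE KERNEL-FOUR LAW, order-`4` case -/

/-- **THE KERNEL-FOUR LAW (lift of order `4`).**  `G` finite, `c` a central involution, `π : G →* D₄` surjective with `π c = r²` and `|ker π| = 4`,
`q` a lift of `s` with `q² ≠ 1` and `q⁴ = 1`: **`μ(G, c) = φ₂(G, c)`**. [folklore] -/
theorem isLeast_card_gfaces_generate_of_dihedral_kernel_four_of_order_four {c : G} (hc2 : c * c = 1) (hcen : ∀ x : G, x * c = c * x)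
    (π : G →* DihedralGroup 4) (hπ : Function.Surjective π) (hπc : π c = r 2) (hker : Nat.card π.ker = 4)
    (q : G) (hq : π q = sr 0) (hq2 : q * q ≠ 1) (hq4 : q * q * (q * q) = 1) :
    IsLeast {n : ℕ | ∃ S : Finset (CMF G c →₀ ℤ), (↑S ⊆ gfaceSet G c hc2) ∧ S.card = n ∧
      hodgeSpan c hc2 ≤ Submodule.span ℤ (pairSet c) ⊔ Submodule.span ℤ (translates c S)} (fibreTwo c hc2) := by
  classical
  have hc1 : c ≠ 1 := by
    intro h; rw [h, map_one] at hπc; exact absurd hπc (by decide)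
  have hG : IsPGroup 2 G := by
    refine IsPGroup.of_card (n := 5) ?_
    have h := card_filter_comap π hπ (univ : Finset (DihedralGroup 4))
    rw [filter_true_of_mem (fun g _ => mem_univ (π g)), card_univ, card_univ, hker] at h
    rw [Nat.card_eq_fintype_card, h]; rfl
  -- the base type and the frame
  let T₀ : CMF G c := ⟨univ.filter fun g : G => π g ∈ ({r 0, r 1, sr 0, sr 1} : Finset (DihedralGroup 4)), isCMF_comap π hπc⟩
  have hT₀ : ∀ P : G, P ∈ T₀.1 ↔ π P ∈ ({r 0, r 1, sr 0, sr 1} : Finset (DihedralGroup 4)) := fun P => by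
    change P ∈ univ.filter (fun g : G => π g ∈ ({r 0, r 1, sr 0, sr 1} : Finset (DihedralGroup 4))) ↔ _
    rw [mem_filter]; simp only [mem_univ, true_and]
  have hn : T₀.1.card = 4 * 4 := by rw [dq_card π hπ T₀ hT₀, hker]
  have hH : (T₀.1 \ (rt c q T₀).1).card = 2 * 4 := by rw [dq_card_H π hπ T₀ hT₀ q hq, hker]
  have hQ₁ : rt c q (rt c q T₀) = T₀ := (dq_swap π T₀ hT₀ q hq q hq).2
  have hσH := dq_sigma_H π hπc T₀ hT₀ q hq q hq
  -- the second swap `Q' = c·g₁qg₁⁻¹`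
  obtain ⟨g₁, hg₁⟩ := hπ (sr 1)
  set Q' : G := c * (g₁ * q * g₁⁻¹) with hQ'def
  have hQ'π : π Q' = sr 0 := by
    rw [hQ'def, map_mul, map_mul, map_mul, map_inv, hπc, hg₁, hq]; decide
  have hQ' : rt c Q' T₀ = rt c q T₀ := (dq_swap π T₀ hT₀ q hq Q' hQ'π).1
  have hQ'₁ : rt c Q' (rt c q T₀) = T₀ := (dq_swap π T₀ hT₀ q hq Q' hQ'π).2
  have hσH' := dq_sigma_H π hπc T₀ hT₀ q hq Q' hQ'π
  have hQQ : Q' * Q' = g₁ * (q * q) * g₁⁻¹ := by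
    calc Q' * Q' = c * (g₁ * q * g₁⁻¹ * c) * (g₁ * q * g₁⁻¹) := by rw [hQ'def]; simp only [mul_assoc]
      _ = c * (c * (g₁ * q * g₁⁻¹)) * (g₁ * q * g₁⁻¹) := by rw [hcen]
      _ = g₁ * (q * q) * g₁⁻¹ := by rw [cmul_cmul c hc2]; group
  have hQ'2 : Q' * Q' ≠ 1 := by
    rw [hQQ]; intro h; apply hq2
    calc q * q = g₁⁻¹ * (g₁ * (q * q) * g₁⁻¹) * g₁ := by group
      _ = 1 := by rw [h]; group
  have hQ'4 : Q' * Q' * (Q' * Q') = 1 := by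
    rw [hQQ]
    calc g₁ * (q * q) * g₁⁻¹ * (g₁ * (q * q) * g₁⁻¹) = g₁ * (q * q * (q * q)) * g₁⁻¹ := by group
      _ = 1 := by rw [hq4]; group
  -- the transversals `T = π⁻¹(r)` and `A' = π⁻¹(s)`
  obtain ⟨hTH, hTm, hTt⟩ := dq_transversal_H π hπ hπc T₀ hT₀ q hq q hq (r 1) (by decide)
  obtain ⟨-, -, hTQ'⟩ := dq_transversal_H π hπ hπc T₀ hT₀ q hq Q' hQ'π (r 1) (by decide)
  obtain ⟨hA'H, hA'm, hA't⟩ := dq_transversal_Hc π hπ hπc T₀ hT₀ q hq Q' hQ'π (sr 0) (by decide)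
  obtain ⟨-, -, hA'Q⟩ := dq_transversal_Hc π hπ hπc T₀ hT₀ q hq q hq (sr 0) (by decide)
  rw [hker] at hTm hA'm
  -- kernel translates preserve the base type and the two halves
  have hrtK : ∀ g : G, π g = 1 → rt c g T₀ = T₀ := fun g hg =>
    Subtype.ext (Finset.ext fun P => by rw [dq_rt_mem π T₀ hT₀, hg, mul_one, hT₀])
  have hHcK : ∀ x : G, x ∈ T₀.1 ∩ (rt c q T₀).1 → ∀ g : G, π g = 1 → x * g⁻¹ ∈ T₀.1 ∩ (rt c q T₀).1 := by
    intro x hx g hg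
    rw [dq_Hcset π T₀ hT₀ q hq, mem_filter] at hx ⊢
    exact ⟨mem_univ _, by rw [map_mul, map_inv, hg, inv_one, mul_one]; exact hx.2⟩
  have hHK : ∀ x : G, x ∈ T₀.1 \ (rt c q T₀).1 → ∀ g : G, π g = 1 → x * g⁻¹ ∈ T₀.1 \ (rt c q T₀).1 := by
    intro x hx g hg
    rw [dq_Hset π T₀ hT₀ q hq, mem_filter] at hx ⊢
    exact ⟨mem_univ _, by rw [map_mul, map_inv, hg, inv_one, mul_one]; exact hx.2⟩
  -- the base cycle `(1, q, q², q³)` of `q` inside `T₀ ∩ T₁`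
  have h1T₀ : (1 : G) ∈ T₀.1 := (hT₀ 1).mpr (by rw [map_one]; decide)
  have hqT₀ : q ∈ T₀.1 := (hT₀ q).mpr (by rw [hq]; decide)
  have h1Hc : (1 : G) ∈ T₀.1 ∩ (rt c q T₀).1 := by
    rw [dq_Hcset π T₀ hT₀ q hq, mem_filter]; exact ⟨mem_univ _, by rw [map_one]; decide⟩
  have r₀ : q = 1 * q ∨ q = c * (1 * q) := Or.inl (one_mul q).symm
  obtain ⟨hz₀, hz₁, r₁, r₂, r₃, ⟨n01, n12, n23, n30, n02, n13⟩, -, hcyc⟩ :=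
    dq_cycle hc2 π hπc T₀ hT₀ q hq q hq hq2 hq4 h1T₀ hqT₀ r₀
  obtain ⟨hqHc, hz₀Hc, hz₁Hc⟩ := hcyc h1Hc
  -- the orbit type `Φ`
  set T : Finset G := univ.filter fun g : G => π g = r 1 with hTdef
  set A' : Finset G := univ.filter fun g : G => π g = sr 0 with hA'def
  have hCsub : ({1, q, 1 * (q * q), q * (q * q)} : Finset G) ⊆ T₀.1 := by
    intro x hx; simp only [mem_insert, mem_singleton] at hx
    rcases hx with rfl | rfl | rfl | rfl
    · exact h1T₀
    · exact hqT₀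
    · exact hz₀
    · exact hz₁
  obtain ⟨Φ, hΦ⟩ := exists_type_of_dev c hc2 T₀ (T ∪ {1, q, 1 * (q * q), q * (q * q)}) (union_subset (hTH.trans sdiff_subset) hCsub)
  refine isLeast_card_gfaces_generate_orbit_four c hc2 hcen T₀ (rt c q T₀) (dq_base π hπc T₀ hT₀ q hq) 4 hn hH hG hc1 rfl q rfl hQ₁ hσH
    Q' hQ' hQ'₁ hσH' T hTH hTm hTt hTQ' A' hA'H hA'm hA't hA'Q h1Hc hqHc hz₀Hc hz₁Hc ⟨r₀, r₁, r₂, r₃, n01, n12, n23, n30, n02, n13⟩ Φ hΦ ?_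
  -- `hcomp`: the translated designated faces
  intro L hLrt hF
  have hsym : ∀ (Θ : CMF G c) (t t' : G), gface c hc2 Θ t t' = gface c hc2 Θ t' t := fun Θ t t' => by
    unfold gface; rw [oflipCM_oflipCM_comm c hc2 t t']; abel
  -- images of the two transversals under right translation
  have hTimg : ∀ g : G, π g = 1 → T.image (fun x => x * g⁻¹) = T := fun g hg => by
    rw [hTdef, image_fibre, hg, inv_one, mul_one]
  have hA'img : ∀ g : G, π g = 1 → A'.image (fun x => x * g⁻¹) = A' := fun g hg => by
    rw [hA'def, image_fibre, hg, inv_one, mul_one]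
  constructor
  · -- the `T₀ ∩ T₁`-side: kernel translates of the face of `Φ`
    intro k hk
    -- `k = g⁻¹` or `k = q·g⁻¹` for a kernel element `g`
    obtain ⟨g, hg, hkg⟩ : ∃ g : G, π g = 1 ∧ (k = 1 * g⁻¹ ∨ k = q * g⁻¹) := by
      have hk' := hk; rw [dq_Hcset π T₀ hT₀ q hq, mem_filter] at hk'
      have hk2 := hk'.2; rw [mem_insert, mem_singleton] at hk2
      rcases hk2 with h | h
      · exact ⟨k⁻¹, by rw [map_inv, h]; decide, Or.inl (by rw [inv_inv, one_mul])⟩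
      · exact ⟨k⁻¹ * q, by rw [map_mul, map_inv, h, hq]; decide, Or.inr (by rw [mul_inv_rev, inv_inv, mul_inv_cancel_left])⟩
    have hΦg : T₀.1 \ (rt c g Φ).1 = T ∪ {1 * g⁻¹, q * g⁻¹, 1 * (q * q) * g⁻¹, q * (q * q) * g⁻¹} := by
      rw [dev_rt_of_stab T₀ Φ g (hrtK g hg), hΦ, image_union, hTimg g hg, image_four]
    have hFg : gface c hc2 (rt c g Φ) (1 * g⁻¹) (q * g⁻¹) ∈ L := by
      have h := hLrt g _ hF; rwa [mapDomain_rt_gface] at h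
    rcases dq_cycle_translate π hπ hc2 hker q hq hq2 hq4 r₀ r₁ r₂ r₃ g hg with ⟨-, s₀, s₁, s₂, s₃⟩ | ⟨-, s₀, s₁, s₂, s₃⟩
    · refine ⟨1 * g⁻¹, q * g⁻¹, 1 * (q * q) * g⁻¹, q * (q * q) * g⁻¹, rt c g Φ, hHcK _ h1Hc g hg, hHcK _ hqHc g hg, hHcK _ hz₀Hc g hg,
        hHcK _ hz₁Hc g hg, ?_, s₀, s₁, s₂, s₃, fun h => n01 (mul_right_cancel h), fun h => n12 (mul_right_cancel h),
        fun h => n23 (mul_right_cancel h), fun h => n30 (mul_right_cancel h), fun h => n02 (mul_right_cancel h),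
        fun h => n13 (mul_right_cancel h), hΦg, hFg⟩
      rcases hkg with h | h
      · exact Or.inl h
      · exact Or.inr (Or.inl h)
    · refine ⟨q * g⁻¹, 1 * g⁻¹, q * (q * q) * g⁻¹, 1 * (q * q) * g⁻¹, rt c g Φ, hHcK _ hqHc g hg, hHcK _ h1Hc g hg, hHcK _ hz₁Hc g hg,
        hHcK _ hz₀Hc g hg, ?_, s₀, s₁, s₂, s₃, fun h => n01 (mul_right_cancel h).symm, fun h => n30 (mul_right_cancel h).symm,
        fun h => n23 (mul_right_cancel h).symm, fun h => n12 (mul_right_cancel h).symm, fun h => n13 (mul_right_cancel h),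
        fun h => n02 (mul_right_cancel h), ?_, by rw [hsym]; exact hFg⟩
      · rcases hkg with h | h
        · exact Or.inr (Or.inl h)
        · exact Or.inl h
      · rw [hΦg, four_swap_pairs]
  · -- the `𝓗`-side: translates by `g₁` and the kernel, for the conjugate swap `Q'`
    intro h hh
    have hg₁T₀ : rt c g₁ T₀ = T₀ :=
      Subtype.ext (Finset.ext fun P => by rw [dq_rt_mem π T₀ hT₀, hg₁, hT₀]; exact dihedral_stab_sr (π P))
    have hTg₁ : T.image (fun x => x * g₁⁻¹) = A' := by
      rw [hTdef, image_fibre, hg₁, show (r 1 : DihedralGroup 4) * (sr 1)⁻¹ = sr 0 by decide]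
    -- the companion orbit type `Ψ₀ = Φ·g₁⁻¹` and its designated face
    have e2 : (1 : G) * (q * q) * g₁⁻¹ = 1 * g₁⁻¹ * (Q' * Q') := by rw [hQQ]; group
    have e3 : q * (q * q) * g₁⁻¹ = q * g₁⁻¹ * (Q' * Q') := by rw [hQQ]; group
    have hΨ₀ : T₀.1 \ (rt c g₁ Φ).1 = A' ∪ {1 * g₁⁻¹, q * g₁⁻¹, 1 * g₁⁻¹ * (Q' * Q'), q * g₁⁻¹ * (Q' * Q')} := by
      rw [dev_rt_of_stab T₀ Φ g₁ hg₁T₀, hΦ, image_union, hTg₁, image_four, e2, e3]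
    have hF₁ : gface c hc2 (rt c g₁ Φ) (1 * g₁⁻¹) (q * g₁⁻¹) ∈ L := by
      have h := hLrt g₁ _ hF; rwa [mapDomain_rt_gface] at h
    -- the base `Q'`-cycle `(g₁⁻¹, qg₁⁻¹, q²g₁⁻¹, q³g₁⁻¹)`
    have hx₀ : (1 : G) * g₁⁻¹ ∈ T₀.1 := (hT₀ _).mpr (by rw [one_mul, map_inv, hg₁]; decide)
    have hx₁ : q * g₁⁻¹ ∈ T₀.1 := (hT₀ _).mpr (by rw [map_mul, map_inv, hq, hg₁]; decide)
    have hx₀H : (1 : G) * g₁⁻¹ ∈ T₀.1 \ (rt c q T₀).1 := by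
      rw [dq_Hset π T₀ hT₀ q hq, mem_filter]; exact ⟨mem_univ _, by rw [one_mul, map_inv, hg₁]; decide⟩
    have ρ₀ : q * g₁⁻¹ = 1 * g₁⁻¹ * Q' ∨ q * g₁⁻¹ = c * (1 * g₁⁻¹ * Q') := by
      right
      have e : (1 : G) * g₁⁻¹ * Q' = c * (q * g₁⁻¹) := by
        rw [hQ'def, one_mul, ← mul_assoc, hcen g₁⁻¹, mul_assoc]; congr 1; group
      rw [e, cmul_cmul c hc2]
    obtain ⟨hy₀, hy₁, ρ₁, ρ₂, ρ₃, ⟨m01, m12, m23, m30, m02, m13⟩, hcycH, -⟩ :=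
      dq_cycle hc2 π hπc T₀ hT₀ q hq Q' hQ'π hQ'2 hQ'4 hx₀ hx₁ ρ₀
    obtain ⟨hx₁H, hx₂H, hx₃H⟩ := hcycH hx₀H
    -- `h = x₀·k⁻¹` or `h = x₁·k⁻¹` for a kernel element `k`
    obtain ⟨k, hk, hhk⟩ : ∃ k : G, π k = 1 ∧ (h = 1 * g₁⁻¹ * k⁻¹ ∨ h = q * g₁⁻¹ * k⁻¹) := by
      have hh' := hh; rw [dq_Hset π T₀ hT₀ q hq, mem_filter] at hh'
      have hh2 := hh'.2; rw [mem_insert, mem_singleton] at hh2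
      rcases hh2 with e | e
      · refine ⟨h⁻¹ * (q * g₁⁻¹), by rw [map_mul, map_mul, map_inv, map_inv, e, hq, hg₁]; decide, Or.inr ?_⟩
        rw [mul_inv_rev, inv_inv, mul_inv_cancel_left]
      · refine ⟨h⁻¹ * (1 * g₁⁻¹), by rw [map_mul, map_mul, map_inv, map_inv, e, map_one, hg₁]; decide, Or.inl ?_⟩
        rw [mul_inv_rev, inv_inv, mul_inv_cancel_left]
    have hΨk : T₀.1 \ (rt c k (rt c g₁ Φ)).1 =
        A' ∪ {1 * g₁⁻¹ * k⁻¹, q * g₁⁻¹ * k⁻¹, 1 * g₁⁻¹ * (Q' * Q') * k⁻¹, q * g₁⁻¹ * (Q' * Q') * k⁻¹} := by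
      rw [dev_rt_of_stab T₀ _ k (hrtK k hk), hΨ₀, image_union, hA'img k hk, image_four]
    have hFk : gface c hc2 (rt c k (rt c g₁ Φ)) (1 * g₁⁻¹ * k⁻¹) (q * g₁⁻¹ * k⁻¹) ∈ L := by
      have h := hLrt k _ hF₁; rwa [mapDomain_rt_gface] at h
    rcases dq_cycle_translate π hπ hc2 hker Q' hQ'π hQ'2 hQ'4 ρ₀ ρ₁ ρ₂ ρ₃ k hk with ⟨-, s₀, s₁, s₂, s₃⟩ | ⟨-, s₀, s₁, s₂, s₃⟩
    · refine ⟨1 * g₁⁻¹ * k⁻¹, q * g₁⁻¹ * k⁻¹, 1 * g₁⁻¹ * (Q' * Q') * k⁻¹, q * g₁⁻¹ * (Q' * Q') * k⁻¹, rt c k (rt c g₁ Φ),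
        hHK _ hx₀H k hk, hHK _ hx₁H k hk, hHK _ hx₂H k hk, hHK _ hx₃H k hk, ?_, s₀, s₁, s₂, s₃,
        fun h => m01 (mul_right_cancel h), fun h => m12 (mul_right_cancel h), fun h => m23 (mul_right_cancel h),
        fun h => m30 (mul_right_cancel h), fun h => m02 (mul_right_cancel h), fun h => m13 (mul_right_cancel h), hΨk, hFk⟩
      rcases hhk with e | e
      · exact Or.inl e
      · exact Or.inr (Or.inl e)
    · refine ⟨q * g₁⁻¹ * k⁻¹, 1 * g₁⁻¹ * k⁻¹, q * g₁⁻¹ * (Q' * Q') * k⁻¹, 1 * g₁⁻¹ * (Q' * Q') * k⁻¹, rt c k (rt c g₁ Φ),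
        hHK _ hx₁H k hk, hHK _ hx₀H k hk, hHK _ hx₃H k hk, hHK _ hx₂H k hk, ?_, s₀, s₁, s₂, s₃,
        fun h => m01 (mul_right_cancel h).symm, fun h => m30 (mul_right_cancel h).symm, fun h => m23 (mul_right_cancel h).symm,
        fun h => m12 (mul_right_cancel h).symm, fun h => m13 (mul_right_cancel h), fun h => m02 (mul_right_cancel h), ?_,
        by rw [hsym]; exact hFk⟩
      · rcases hhk with e | e
        · exact Or.inr (Or.inl e)
        · exact Or.inl e
      · rw [hΨk, four_swap_pairs]

/-! ## §3 Any reflection; `μ = β − 2` -/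

/-- The automorphism `r j ↦ r j`, `sr j ↦ sr (j − i)` of `D₄` as a function (it fixes `r²` and carries `sr i` to `s = sr 0`). [folklore] -/
theorem dihedral_shift_mul : ∀ (i : ZMod 4) (a b : DihedralGroup 4),
    (match a * b with | r j => r j | sr j => sr (j - i) : DihedralGroup 4) =
      (match a with | r j => r j | sr j => sr (j - i) : DihedralGroup 4) * (match b with | r j => r j | sr j => sr (j - i)) := by decide

/-- The shift automorphism is injective on `D₄` (kernel trivial) and surjective. [folklore] -/
theorem dihedral_shift_bij : ∀ (i : ZMod 4),
    (∀ a : DihedralGroup 4, (match a with | r j => r j | sr j => sr (j - i) : DihedralGroup 4) = 1 ↔ a = 1) ∧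
    (∀ y : DihedralGroup 4, ∃ a : DihedralGroup 4, (match a with | r j => r j | sr j => sr (j - i) : DihedralGroup 4) = y) := by decide

/-- **THE KERNEL-FOUR LAW (any reflection, lift of order dividing `4`).**  `G` finite, `c` a central involution, `π : G →* D₄` surjective with
`π c = r²` and `|ker π| = 4`, and SOME reflection `sr i` lifting to an element `g` with `g⁴ = 1`: **`μ(G, c) = φ₂(G, c)`** — part X if `g² = 1`,
the order-`4` case otherwise, after moving `sr i` to `s` by the automorphism `sr j ↦ sr (j − i)` of `D₄`. [folklore] -/
theorem isLeast_card_gfaces_generate_of_dihedral_kernel_four {c : G} (hc2 : c * c = 1) (hcen : ∀ x : G, x * c = c * x)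
    (π : G →* DihedralGroup 4) (hπ : Function.Surjective π) (hπc : π c = r 2) (hker : Nat.card π.ker = 4)
    (i : ZMod 4) (g : G) (hg : π g = sr i) (hg4 : g * g * (g * g) = 1) :
    IsLeast {n : ℕ | ∃ S : Finset (CMF G c →₀ ℤ), (↑S ⊆ gfaceSet G c hc2) ∧ S.card = n ∧
      hodgeSpan c hc2 ≤ Submodule.span ℤ (pairSet c) ⊔ Submodule.span ℤ (translates c S)} (fibreTwo c hc2) := by
  classical
  -- the twisted surjection
  let ψ : DihedralGroup 4 →* DihedralGroup 4 :=
    { toFun := fun x => match x with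
        | r j => r j
        | sr j => sr (j - i)
      map_one' := rfl
      map_mul' := dihedral_shift_mul i }
  have hψ1 : ∀ a : DihedralGroup 4, ψ a = 1 ↔ a = 1 := (dihedral_shift_bij i).1
  have hψsurj : Function.Surjective ψ := fun y => (dihedral_shift_bij i).2 y
  have hπ' : Function.Surjective (ψ.comp π) := hψsurj.comp hπ
  have hπc' : (ψ.comp π) c = r 2 := by rw [MonoidHom.comp_apply, hπc]; rfl
  have hker' : Nat.card (ψ.comp π).ker = 4 := by
    have e : (ψ.comp π).ker = π.ker := by
      ext x; rw [MonoidHom.mem_ker, MonoidHom.mem_ker, MonoidHom.comp_apply, hψ1]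
    rw [e]; exact hker
  have hg' : (ψ.comp π) g = sr 0 := by
    rw [MonoidHom.comp_apply, hg]; change sr (i - i) = sr 0; rw [sub_self]
  by_cases hgg : g * g = 1
  · have hG : IsPGroup 2 G := by
      refine IsPGroup.of_card (n := 5) ?_
      have h := card_filter_comap π hπ (univ : Finset (DihedralGroup 4))
      rw [filter_true_of_mem (fun g _ => mem_univ (π g)), card_univ, card_univ, hker] at h
      rw [Nat.card_eq_fintype_card, h]; rfl
    exact isLeast_card_gfaces_generate_of_dihedral_quotient hG hc2 hcen (ψ.comp π) hπ' hπc' (by rw [hker']) g hg' hgg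
  · exact isLeast_card_gfaces_generate_of_dihedral_kernel_four_of_order_four hc2 hcen (ψ.comp π) hπ' hπc' hker' g hg' hgg hg4

/-- **`μ = β − 2`** under the same hypotheses (part XI: `φ₂ + 2 = β` for every dihedral quotient). [folklore] -/
theorem isLeast_card_gfaces_generate_of_dihedral_kernel_four_block {c : G} (hc2 : c * c = 1) (hcen : ∀ x : G, x * c = c * x)
    (π : G →* DihedralGroup 4) (hπ : Function.Surjective π) (hπc : π c = r 2) (hker : Nat.card π.ker = 4)
    (i : ZMod 4) (g : G) (hg : π g = sr i) (hg4 : g * g * (g * g) = 1) :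
    IsLeast {n : ℕ | ∃ S : Finset (CMF G c →₀ ℤ), (↑S ⊆ gfaceSet G c hc2) ∧ S.card = n ∧
      hodgeSpan c hc2 ≤ Submodule.span ℤ (pairSet c) ⊔ Submodule.span ℤ (translates c S)} (Fintype.card (Block c) - 2) := by
  classical
  have hG : IsPGroup 2 G := by
    refine IsPGroup.of_card (n := 5) ?_
    have h := card_filter_comap π hπ (univ : Finset (DihedralGroup 4))
    rw [filter_true_of_mem (fun g _ => mem_univ (π g)), card_univ, card_univ, hker] at h
    rw [Nat.card_eq_fintype_card, h]; rfl
  have h := fibreTwo_add_two_eq_card_block_of_dihedral_quotient' hG hc2 hcen π hπ hπc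
  rw [show Fintype.card (Block c) - 2 = fibreTwo c hc2 by omega]
  exact isLeast_card_gfaces_generate_of_dihedral_kernel_four hc2 hcen π hπ hπc hker i g hg hg4

end

end Summit.HodgeConjecture.CorCM.Census.CentralSquares
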